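import Mathlib
import HarnessLib
import Summits.QuantumAdvantage.QuantumAdvantage.Theorems.SyndeticDialE

/-!
# SyndeticDial, part F (§7 REV2b — the KERNEL NO-GO AT REACH √n `not_twoTier_of_qAt_sqrt`: given Q, no absorption-factored length bridge reaches √n) — support for item stmt-QuantumAdvantage-28401

Cell decomp-qadv, seat lens-5 («finite range + asymptotic regime + bridge»), generation 27 — land port of the REV2 additions of
the node «SyndeticDial» (HOME/decomp-qadv-lens-5/g27/SyndeticDial.lean sha256 22d5bb09…, record NODE-g27.md N7; RESIDUAL MODE on
AbsorptionDial:28401 `MassHiQuasi`).  Parts A–D are IN THE TREE (A p819709 / B p819783 / C p819944 / D `SyndeticDialD`); the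
REV2 additions land as parts E (this mechanism's finite form) and F (its asymptotic no-go), each with ONLY the namespace renamed
`Theses.SyndeticDial → Theorems.SyndeticDial`.
PART F: the KERNEL NO-GO AT REACH √n `not_twoTier_of_qAt_sqrt : (∃ n₁, ∀ n ≥ n₁, Nat.sqrt n ≤ f n) → QAt p → ¬ TwoTier p f`
— at the length m = n − √n the two-tier statement charges cuts 0, 1 a degree 2√n·(log₂ n)^(A'+1) (C = A' + 1 is the refuter's
to choose), above a prime power p^k ≥ 4(√n + 1)(log₂ n)^A' + 1 (`ceiling_arith₁/₂`); part E's periodic two-cut strategy then wins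
on the central weight window of width p^k (`window_le_of_hardR₂`), whose complement has mass ≤ 2·exp(−(p^k − 1)²/(2m)) ≤
2^(−(log₂ n)^A' − 1) (`card_wt_upper_le`/`card_wt_lower_le`) < the loss 2^(−(log₂ n)^A') two-tier hardness demands — ;
globally `not_twoTierPiece_sqrt_of_quasiLoss : (f ≥ √n ev.) → QuasiLoss → ¬ TwoTierPiece f`, `twoTierPiece_sqrt_inconsistent :
(f ≥ √n ev.) → QuarterFloor → SyndPiece f → TwoTierPiece f → False`, `sqrt_le_half`.  With part D's `twoTier_polylog` and
`not_twoTier_half_of_qAt` this CERTIFIES the reach ceiling of the absorption mechanism (the only known length-transfer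
mechanism for the odd-prime walk game): EXACT ≤ polylog, DEAD from √n on (given Q), OPEN strictly between (Smolensky regime).
Tree facts reused by name: part D's `HardR₂/hardR₂_anti/hardR₂_anti_low/not_hardR₂_of_le/TwoTier/TwoTierPiece/hardAt_of_qAt/
closes_twoTier`, parts A–C's `HardAt/QAt/SyndPiece/half/quasiLoss_iff_qAt`, part E's `window_le_of_hardR₂/card_wt_upper_le/
card_wt_lower_le`, `LengthDial.QuasiLoss/QuarterFloor/massHiQuasi_unfold`.  No `sorry`, no new axioms, no instances, no notation.
-/

set_option autoImplicit false
set_option linter.dupNamespace false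

namespace Summit.QuantumAdvantage.QuantumAdvantage.Theorems.SyndeticDial

open Finset
open Summit.QuantumAdvantage.AdviceFreeQNC0
open Literature.Computability.MetaComplexity Literature.Computability.MetaComplexity.Smolensky
open Summit.QuantumAdvantage.QuantumAdvantage.Theorems.LengthDial
open Summit.QuantumAdvantage.QuantumAdvantage.Theorems.AbsorptionDial

/-! ## §7 (REV2b) THE KERNEL NO-GO AT REACH √n -/

section SqrtCeiling

variable {p : ℕ} [Fact p.Prime]

/-- integer bookkeeping for `not_twoTier_of_qAt_sqrt` (i): the prime power below the top degree is large. -/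
theorem ceiling_arith₁ {r s X Y q : ℕ} (hs1 : 1 ≤ s) (hYX : 4 * r * X ≤ Y)
    (h1 : (2 * s + 1) * Y + 3 ≤ r * q) : 4 * (s + 1) * X + 1 ≤ q := by
  by_contra hcon
  have hq : q ≤ 4 * (s + 1) * X := by omega
  have h2 : r * q ≤ r * (4 * (s + 1) * X) := Nat.mul_le_mul_left _ hq
  have h3 : (2 * s + 1) * (4 * r * X) ≤ (2 * s + 1) * Y := Nat.mul_le_mul_left _ hYX
  have h4 : r * (4 * (s + 1) * X) ≤ (2 * s + 1) * (4 * r * X) := by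
    have : 4 * (s + 1) ≤ 4 * (2 * s + 1) := by omega
    calc r * (4 * (s + 1) * X) = (4 * (s + 1)) * (r * X) := by ring
      _ ≤ (4 * (2 * s + 1)) * (r * X) := Nat.mul_le_mul_right _ this
      _ = (2 * s + 1) * (4 * r * X) := by ring
  omega

/-- integer bookkeeping for `not_twoTier_of_qAt_sqrt` (ii): the squared window width beats `2M·(X + 2)`. -/
theorem ceiling_arith₂ {s X q M n : ℕ} (hX1 : 1 ≤ X) (hns : n < (s + 1) * (s + 1)) (hMn : M ≤ n)
    (hq : 4 * (s + 1) * X + 1 ≤ q) : 2 * M * (X + 2) ≤ (q - 1) * (q - 1) := by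
  have hq1 : 4 * (s + 1) * X ≤ q - 1 := by omega
  have h1 : 2 * M * (X + 2) ≤ 2 * n * (3 * X) :=
    Nat.mul_le_mul (Nat.mul_le_mul_left _ hMn) (by omega)
  have h2 : 2 * n * (3 * X) ≤ 2 * ((s + 1) * (s + 1)) * (3 * X) :=
    Nat.mul_le_mul_right _ (Nat.mul_le_mul_left _ hns.le)
  have h3 : 2 * ((s + 1) * (s + 1)) * (3 * X) ≤ (4 * (s + 1) * X) * (4 * (s + 1) * X) := by
    have hX : 6 * X ≤ 16 * (X * X) := by nlinarith
    calc 2 * ((s + 1) * (s + 1)) * (3 * X) = ((s + 1) * (s + 1)) * (6 * X) := by ring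
      _ ≤ ((s + 1) * (s + 1)) * (16 * (X * X)) := Nat.mul_le_mul_left _ hX
      _ = (4 * (s + 1) * X) * (4 * (s + 1) * X) := by ring
  exact h1.trans (h2.trans (h3.trans (Nat.mul_le_mul hq1 hq1)))

/-- **KERNEL NO-GO AT REACH `√n` — THE WEIGHT-WINDOW CEILING.**  Two-tier robustness of any reach `f(n) ≥ √n`
(eventually) is FALSE given Q: at the length `m = n − √n` the top two cuts are charged a degree `≥ 2√n·(log₂ n)^C`
with `C = A' + 1` of OUR choosing, which exceeds `p^k − 1` for a prime power `p^k ≥ 4(√n + 1)(log₂ n)^{A'} + 1`; the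
periodic two-cut strategy (`window_le_of_hardR₂`, Lucas by name) then wins on the central weight window of width `p^k`,
whose complement has mass `≤ 2·exp(−(p^k − 1)²/(2m)) ≤ 2^{−(log₂ n)^{A'} − 1}` (Hoeffding by name,
`card_wt_upper_le` / `card_wt_lower_le`) — less than the loss `2^{−(log₂ n)^{A'}}` that two-tier hardness demands.
With `not_twoTier_half_of_qAt` (reach `n/2`, elementary) this certifies the reach ceiling of the absorption mechanism:
EXACT `≤ polylog` (`twoTier_polylog`), DEAD from `√n` on (this theorem), OPEN strictly between (module docstring §B'). -/
theorem not_twoTier_of_qAt_sqrt {f : ℕ → ℕ} (hf : ∃ n₁ : ℕ, ∀ n ≥ n₁, Nat.sqrt n ≤ f n) (hQ : QAt p) :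
    ¬ TwoTier p f := by
  classical
  intro hT
  have hp : p.Prime := Fact.out
  have hp1 : 1 < p := hp.one_lt
  obtain ⟨A, hA⟩ := hardAt_of_qAt hQ
  obtain ⟨A', hA'⟩ := hT A
  obtain ⟨C', n₀, hn₀⟩ := hA' (A' + 1)
  obtain ⟨n₀', hn₀'⟩ := hA C'
  obtain ⟨n₁, hn₁⟩ := hf
  -- a large length scale `n`
  obtain ⟨e, he⟩ : ∃ e, e = 16 ^ p := ⟨_, rfl⟩
  obtain ⟨n, hnn₀, hnn₀', hnn₁, hn16⟩ : ∃ n, n₀ ≤ n ∧ n₀' ≤ n ∧ n₁ ≤ n ∧ 16 ^ p ≤ n :=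
    ⟨n₀ + n₀' + n₁ + e, by omega, by omega, by omega, by omega⟩
  have h16 : 16 ≤ 16 ^ p := by
    calc (16 : ℕ) = 16 ^ 1 := by norm_num
      _ ≤ 16 ^ p := Nat.pow_le_pow_right (by norm_num) hp.one_le
  have hn16' : 16 ≤ n := h16.trans hn16
  set L := Nat.log 2 n with hL
  have hL4p : 4 * p ≤ L := by
    apply Nat.le_log_of_pow_le (by norm_num)
    calc 2 ^ (4 * p) = 16 ^ p := by rw [pow_mul]; norm_num
      _ ≤ n := hn16
  have hL1 : 1 ≤ L := by omega
  set s := Nat.sqrt n with hs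
  have hss : s * s ≤ n := Nat.sqrt_le n
  have hns : n < (s + 1) * (s + 1) := Nat.lt_succ_sqrt n
  have hs1 : 1 ≤ s := by rw [hs]; exact Nat.sqrt_pos.2 (by omega)
  have h2s : 2 * s ≤ n := by nlinarith [hss, hns, hn16']
  -- the length `m = n − s = m' + 1`
  obtain ⟨m', hm'⟩ : ∃ m', n - s = m' + 1 := ⟨n - s - 1, by omega⟩
  have hm1 : n - n / 2 ≤ n - s := by omega
  have hm2 : n - f n ≤ n - s := Nat.sub_le_sub_left (hn₁ n hnn₁) n
  have hHA : HardAt p A C' n (n - s) := hn₀' n hnn₀' (n - s) hm1 (Nat.sub_le _ _)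
  have h2 := hn₀ n hnn₀ (n - s) hm2 (Nat.sub_le _ _) hHA
  have hgap : n - (n - s) = s := by omega
  rw [hgap, hm'] at h2
  -- integer bookkeeping
  have hX1 : 1 ≤ L ^ A' := Nat.one_le_pow _ _ (by omega)
  have hYX : 4 * p * L ^ A' ≤ L ^ (A' + 1) := by
    rw [pow_succ]
    calc 4 * p * L ^ A' = L ^ A' * (4 * p) := by ring
      _ ≤ L ^ A' * L := Nat.mul_le_mul_left _ hL4p
  -- the prime power `q = p^k` just below the top degree `D + 1`
  set D := L ^ (A' + 1) + (2 * (s * L ^ (A' + 1)) + 1) with hD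
  set k := Nat.log p (D + 1) with hk
  have hqD : p ^ k ≤ D + 1 := Nat.pow_log_le_self p (by omega)
  have hDq : D + 1 < p ^ k * p := by
    have := Nat.lt_pow_succ_log_self hp1 (D + 1)
    rwa [pow_succ] at this
  have hq1 : 1 ≤ p ^ k := Nat.one_le_pow _ _ hp.pos
  have hq4 : 4 * (s + 1) * L ^ A' + 1 ≤ p ^ k := by
    have hD' : D + 2 = (2 * s + 1) * L ^ (A' + 1) + 3 := by rw [hD]; ring
    have h1b : D + 2 ≤ p * p ^ k := by rw [mul_comm]; omega
    exact ceiling_arith₁ hs1 hYX (hD' ▸ h1b)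
  have hq2 : 2 * (m' + 1) * (L ^ A' + 2) ≤ (p ^ k - 1) * (p ^ k - 1) :=
    ceiling_arith₂ hX1 hns (by omega) hq4
  have hθ1 : (1 : ℝ) - 1 / (2 : ℝ) ^ (L ^ A') < 1 := by
    have : (0 : ℝ) < 1 / (2 : ℝ) ^ (L ^ A') := by positivity
    linarith
  by_cases hqm : m' + 1 ≤ p ^ k - 1
  · -- the window swallows every weight: the two-cut defeat applies verbatim
    exact not_hardR₂_of_le hθ1 (hqm.trans (by omega)) h2
  have hqM : p ^ k ≤ m' + 1 := by omega
  have h3 : HardR₂ p (m' + 1) 0 (p ^ k - 1) (1 - 1 / (2 : ℝ) ^ (L ^ A')) :=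
    hardR₂_anti_low (hardR₂_anti h2 (by omega)) (Nat.zero_le _)
  -- the central window `[N₀, N₀ + q)`, `N₀ = (m'+1)/2 − q/2`, and the two tails at `t = (q − 1)/2`
  have hw := window_le_of_hardR₂ (N₀ := (m' + 1) / 2 - p ^ k / 2) h3 0
  have ht0 : (0 : ℝ) ≤ ((p ^ k : ℕ) - 1 : ℝ) / 2 := by
    have : (1 : ℝ) ≤ (p ^ k : ℕ) := by exact_mod_cast hq1
    linarith
  have hM0 : 0 < m' + 1 := Nat.succ_pos m'
  have hlow := card_wt_lower_le (m := m' + 1) hM0 ht0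
  have hhigh := card_wt_upper_le (m := m' + 1) hM0 ht0
  -- every input is in the window or in one of the two tails
  have hcover : (2 : ℝ) ^ (m' + 1) ≤
      ((univ.filter fun u : Fin (m' + 1) → Bool =>
          (m' + 1) / 2 - p ^ k / 2 ≤ wt u ∧ wt u < (m' + 1) / 2 - p ^ k / 2 + p ^ k).card : ℝ)
      + ((univ.filter fun u : Fin (m' + 1) → Bool =>
          ((p ^ k : ℕ) - 1 : ℝ) / 2 ≤ ((m' + 1 : ℕ) : ℝ) / 2 - (wt u : ℝ)).card : ℝ)
      + ((univ.filter fun u : Fin (m' + 1) → Bool =>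
          ((p ^ k : ℕ) - 1 : ℝ) / 2 ≤ (wt u : ℝ) - ((m' + 1 : ℕ) : ℝ) / 2).card : ℝ) := by
    have hdiv₁ := Nat.div_add_mod (m' + 1) 2
    have hmod₁ := Nat.mod_lt (m' + 1) (show 0 < 2 by norm_num)
    have hdiv₂ := Nat.div_add_mod (p ^ k) 2
    have hmod₂ := Nat.mod_lt (p ^ k) (show 0 < 2 by norm_num)
    have hqq : p ^ k / 2 ≤ (m' + 1) / 2 := Nat.div_le_div_right hqM
    have hsub : (Finset.univ : Finset (Fin (m' + 1) → Bool)) ⊆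
        (univ.filter fun u : Fin (m' + 1) → Bool =>
            (m' + 1) / 2 - p ^ k / 2 ≤ wt u ∧ wt u < (m' + 1) / 2 - p ^ k / 2 + p ^ k)
        ∪ (univ.filter fun u : Fin (m' + 1) → Bool =>
            ((p ^ k : ℕ) - 1 : ℝ) / 2 ≤ ((m' + 1 : ℕ) : ℝ) / 2 - (wt u : ℝ))
        ∪ (univ.filter fun u : Fin (m' + 1) → Bool =>
            ((p ^ k : ℕ) - 1 : ℝ) / 2 ≤ (wt u : ℝ) - ((m' + 1 : ℕ) : ℝ) / 2) := by
      intro u _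
      simp only [Finset.mem_union, Finset.mem_filter, Finset.mem_univ, true_and]
      by_cases hlo : wt u < (m' + 1) / 2 - p ^ k / 2
      · left; right
        have h4 : 2 * wt u + p ^ k ≤ m' + 1 := by omega
        have h5 : (2 * wt u + p ^ k : ℕ) ≤ ((m' + 1 : ℕ) : ℝ) := by exact_mod_cast h4
        push_cast at h5 ⊢
        linarith
      · by_cases hhi : (m' + 1) / 2 - p ^ k / 2 + p ^ k ≤ wt u
        · right
          have h4 : m' + p ^ k ≤ 2 * wt u := by omega
          have h5 : ((m' + p ^ k : ℕ) : ℝ) ≤ ((2 * wt u : ℕ) : ℝ) := by exact_mod_cast h4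
          push_cast at h5 ⊢
          linarith
        · left; left
          omega
    have hc := Finset.card_le_card hsub
    have hU : (Finset.univ : Finset (Fin (m' + 1) → Bool)).card = 2 ^ (m' + 1) := by
      rw [Finset.card_univ, Fintype.card_fun, Fintype.card_bool, Fintype.card_fin]
    have hc' := (hc.trans (Finset.card_union_le _ _)).trans
      (Nat.add_le_add_right (Finset.card_union_le _ _) _)
    rw [hU] at hc'
    exact_mod_cast hc'
  -- the tail mass is at most `2^{−(L^{A'} + 2)}` each
  have he : Real.exp (-(2 * (((p ^ k : ℕ) - 1 : ℝ) / 2) ^ 2 / ((m' + 1 : ℕ) : ℝ)))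
      ≤ 1 / (2 : ℝ) ^ (L ^ A' + 2) := by
    have hM : (0 : ℝ) < ((m' + 1 : ℕ) : ℝ) := by positivity
    have hc : ((2 * (m' + 1) * (L ^ A' + 2) : ℕ) : ℝ) ≤ (((p ^ k - 1) * (p ^ k - 1) : ℕ) : ℝ) := by
      exact_mod_cast hq2
    push_cast [Nat.cast_sub hq1] at hc
    have hge : ((L ^ A' + 2 : ℕ) : ℝ) ≤ 2 * (((p ^ k : ℕ) - 1 : ℝ) / 2) ^ 2 / ((m' + 1 : ℕ) : ℝ) := by
      rw [le_div_iff₀ hM]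
      push_cast
      nlinarith [hc]
    -- `2^j ≤ e^j` (as in the tree's `Literature…ZoomTheoremProofs.two_pow_le_exp`, three lines, not imported for it)
    have h2e : (2 : ℝ) ^ (L ^ A' + 2) ≤ Real.exp ((L ^ A' + 2 : ℕ) : ℝ) := by
      have h2 : (2 : ℝ) ≤ Real.exp 1 := by
        have := Real.add_one_le_exp (1 : ℝ)
        norm_num at this
        exact this
      calc (2 : ℝ) ^ (L ^ A' + 2) ≤ (Real.exp 1) ^ (L ^ A' + 2) := pow_le_pow_left₀ (by norm_num) h2 _
        _ = Real.exp ((L ^ A' + 2 : ℕ) : ℝ) := by rw [← Real.exp_nat_mul, mul_one]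
    calc Real.exp (-(2 * (((p ^ k : ℕ) - 1 : ℝ) / 2) ^ 2 / ((m' + 1 : ℕ) : ℝ)))
        ≤ Real.exp (-((L ^ A' + 2 : ℕ) : ℝ)) := Real.exp_le_exp.2 (by linarith)
      _ = 1 / Real.exp ((L ^ A' + 2 : ℕ) : ℝ) := by rw [Real.exp_neg, one_div]
      _ ≤ 1 / (2 : ℝ) ^ (L ^ A' + 2) := one_div_le_one_div_of_le (by positivity) h2e
  -- bookkeeping: window ≤ θ·2^M, tails ≤ 2^{M − L^{A'} − 2} each ⟹ 2^M ≤ 2^M·(1 − 2^{−L^{A'} − 1})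
  have hW : (0 : ℝ) < (2 : ℝ) ^ (m' + 1) := by positivity
  have ha : (0 : ℝ) < 1 / (2 : ℝ) ^ (L ^ A') := by positivity
  have h4 : (1 : ℝ) / (2 : ℝ) ^ (L ^ A' + 2) = (1 / (2 : ℝ) ^ (L ^ A')) / 4 := by
    rw [pow_add]; field_simp; ring
  have htail : Real.exp (-(2 * (((p ^ k : ℕ) - 1 : ℝ) / 2) ^ 2 / ((m' + 1 : ℕ) : ℝ))) * (2 : ℝ) ^ (m' + 1)
      ≤ (1 / (2 : ℝ) ^ (L ^ A')) / 4 * (2 : ℝ) ^ (m' + 1) := by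
    rw [← h4]; exact mul_le_mul_of_nonneg_right he hW.le
  linarith [hcover, hw, hlow, hhigh, htail, mul_pos ha hW]

/-- **GLOBAL KERNEL NO-GO AT REACH `√n`**: given Q, the two-tier robustness piece of ANY reach `f ≥ √n` (eventually) is
false — the weight-window ceiling `not_twoTier_of_qAt_sqrt` at the prime `5`. -/
theorem not_twoTierPiece_sqrt_of_quasiLoss {f : ℕ → ℕ} (hf : ∃ n₁ : ℕ, ∀ n ≥ n₁, Nat.sqrt n ≤ f n) (hQ : QuasiLoss) :
    ¬ TwoTierPiece f := fun hT =>
  haveI : Fact (Nat.Prime 5) := ⟨by norm_num⟩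
  not_twoTier_of_qAt_sqrt hf (quasiLoss_iff_qAt.1 hQ 5 le_rfl) (hT 5 le_rfl)

/-- hence under the floor no absorption-factored split `S_f ∧ TwoTier_f` with `f ≥ √n` is consistent: the two pieces and
the floor prove `False` (they prove T by `closes_twoTier`, T gives Q, Q refutes the two-tier piece). -/
theorem twoTierPiece_sqrt_inconsistent {f : ℕ → ℕ} (hf : ∃ n₁ : ℕ, ∀ n ≥ n₁, Nat.sqrt n ≤ f n) (hF : QuarterFloor)
    (hS : SyndPiece f) (hT : TwoTierPiece f) : False :=
  not_twoTierPiece_sqrt_of_quasiLoss hf (massHiQuasi_unfold.1 (closes_twoTier f hS hT) hF) hT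

/-- in particular at reach `half` again (`n/2 ≥ √n`), now through the weight-window ceiling. -/
theorem sqrt_le_half : ∃ n₁ : ℕ, ∀ n ≥ n₁, Nat.sqrt n ≤ half n := by
  refine ⟨4, fun n hn => ?_⟩
  have h := Nat.sqrt_le n
  show Nat.sqrt n ≤ n / 2
  by_contra hcon
  have h2 : n / 2 + 1 ≤ Nat.sqrt n := by omega
  have h3 : (n / 2 + 1) * (n / 2 + 1) ≤ n := (Nat.mul_le_mul h2 h2).trans h
  nlinarith [Nat.div_add_mod n 2, Nat.mod_lt n (show 0 < 2 by norm_num)]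

end SqrtCeiling

end Summit.QuantumAdvantage.QuantumAdvantage.Theorems.SyndeticDial
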